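import Summits.Ventures.PercRepro.ProfilePointedCircuitClassesStarSharpParXA

/-!
# PercRepro — THE REGIME `b ∥ y`, `y ∈ X`, OF CASE D0, PART B: EVERY BAD DEMAND WITH `c1` HAS AN OFF C-ENDPOINT
(p5, gen 55; `proofs/P5-GM1.md` §82 ADD 7)

`parX_line_of_plane` (S): an endpoint `p` on an ON plane `{e, f, p}` has `y ∈ cl{e, p}`; `parX_rk_erase_eq_four_of_line`
(T): then the other endpoint `q` has `ρ(X − q) = 4`; `parX_off_cpoint_of_c1`: every bad demand with `c1` has an
endpoint `x` with `ρ{e, f, x} = 3`, `ρ(X − x) = 4` and `y ∉ cl{e, f, x}` (an OFF C-point; §82 ADD 7).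
Part A: `b ∥ y` makes a set ON iff `y` lies in its closure; the bad demands without `c1` are defects of `R`, those
with `c1` avoid `y`, have both endpoints off the line `ef`, and their OFF C-points are private (`parX_private`).
-/

open scoped Matroid

namespace PercRepro.Cogirth

open Finset ThmH Skew Shadow Profile

open Classical

variable {α : Type} [DecidableEq α] {N : Matroid α} [N.Finite]

section StarSharpParXB

variable {b b' : α}

/-- `(S)`: if `y ∈ cl{e, f, p}` for an endpoint `p` of a demand with `c1`, then `y ∈ cl{e, p}`. -/
theorem parX_line_of_plane (hn : (gr N).card = 9) (h : SeriesPair N b b') {e f : α} (he : e ∈ gr N) (hf : f ∈ gr N)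
    (hef : e ≠ f) (heb : e ≠ b) (heb' : e ≠ b') (hfb : f ≠ b) (hfb' : f ≠ b')
    (he1 : ∀ y ∈ ((((gr N).erase b).erase b').erase f).erase e, rk N {e, y} = 2)
    (hf1 : ∀ y ∈ ((((gr N).erase b).erase b').erase f).erase e, rk N {f, y} = 2)
    {y : α} (hyX : y ∈ ((((gr N).erase b).erase b').erase f).erase e) (hpar : rk N {y, b, b'} = 2)
    (hbb2 : rk N {b, b'} = 2) {W : Finset α} (hW : W ∈ d0DON N b' e f) (hc1 : d0c1 N b e f W) {p : α}
    (hp : p ∈ (W.erase b).erase e) (hyplane : rk N (insert y {e, f, p}) = 3) : rk N (insert y {e, p}) = 2 := by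
  have hXE : ((((gr N).erase b).erase b').erase f).erase e ⊆ ((gr N).erase b).erase b' :=
    (erase_subset _ _).trans (erase_subset _ _)
  have hXg : ((((gr N).erase b).erase b').erase f).erase e ⊆ gr N :=
    hXE.trans ((erase_subset _ _).trans (erase_subset _ _))
  have heE : e ∈ ((gr N).erase b).erase b' := mem_erase.2 ⟨heb', mem_erase.2 ⟨heb, he⟩⟩
  have hy1 : rk N ({y} : Finset α) = 1 := by
    have h1 := rk_insert_le_add_one (N := N) he (X := ({y} : Finset α)) (singleton_subset_iff.2 (hXg hyX))
    have h2 := rk_le_card' (M := N) ({y} : Finset α)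
    rw [card_singleton] at h2
    rw [he1 y hyX] at h1
    omega
  have hWd := hW
  simp only [d0DON, mem_filter] at hWd
  obtain ⟨-, hπX, -, -, -, hπe, -, hon⟩ := d0_demand_data h hn hf hef heb hfb hfb' (e := e) W hWd.1 hWd.2.1 hWd.2.2
  have hyπ : rk N (insert y (insert e ((W.erase b).erase e))) = rk N (insert e ((W.erase b).erase e)) :=
    (on_iff_of_parallel h (hXE hyX) hy1 hpar hbb2 (insert_subset heE (hπX.trans hXE))).1 (by rw [hπe]; exact hon)
  have hpX := hπX hp
  have h1 : rk N (insert y {e, p}) ≤ 2 := by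
    apply rk_le_two_of_two_planes (N := N) (S₁ := insert y {e, f, p}) (S₂ := insert y (insert e ((W.erase b).erase e)))
      (U := insert f (insert e ((W.erase b).erase e)))
    · intro u hu; simp only [mem_insert, mem_singleton] at hu
      rcases hu with rfl | rfl | rfl
      · exact mem_inter.2 ⟨mem_insert_self _ _, mem_insert_self _ _⟩
      · exact mem_inter.2 ⟨mem_insert_of_mem (mem_insert_self _ _), mem_insert_of_mem (mem_insert_self _ _)⟩
      · exact mem_inter.2 ⟨mem_insert_of_mem (mem_insert_of_mem (mem_insert_of_mem (mem_singleton_self _))),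
          mem_insert_of_mem (mem_insert_of_mem hp)⟩
    · intro u hu
      rw [mem_insert] at hu
      rcases hu with rfl | hu
      · exact mem_union_left _ (mem_insert_of_mem (mem_insert_of_mem (mem_insert_self _ _)))
      · exact mem_union_right _ (mem_insert_of_mem hu)
    · unfold d0c1 at hc1; exact hc1
    · rw [hyplane]
    · rw [hyπ, hπe]
  have h2 : rk N {e, p} ≤ rk N (insert y {e, p}) := rk_mono' (subset_insert _ _)
  rw [he1 p hpX] at h2
  omega

/-- `(T)`: an endpoint `p` with `y ∈ cl{e, p}` of a bad demand with `c1`: the other endpoint `q` has `ρ(X − q) = 4`. -/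
theorem parX_rk_erase_eq_four_of_line (hn : (gr N).card = 9) (h : SeriesPair N b b') {e f : α} (he : e ∈ gr N)
    (hf : f ∈ gr N) (hef : e ≠ f) (heb : e ≠ b) (heb' : e ≠ b') (hfb : f ≠ b) (hfb' : f ≠ b')
    (he1 : ∀ y ∈ ((((gr N).erase b).erase b').erase f).erase e, rk N {e, y} = 2)
    (hfc : ∀ y ∈ ((((gr N).erase b).erase b').erase f).erase e, rk N (((((gr N).erase b).erase b').erase f).erase y) = 4)
    {y : α} (hyX : y ∈ ((((gr N).erase b).erase b').erase f).erase e) (hpar : rk N {y, b, b'} = 2)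
    (hbb2 : rk N {b, b'} = 2) {W : Finset α} (hW : W ∈ d0DON N b' e f) (hc0 : ¬ d0c0 N b b' e f W)
    (hc1 : d0c1 N b e f W) (hc2 : ¬ d0c2 N b b' e f W) {p q : α} (hp : p ∈ (W.erase b).erase e)
    (hq : q ∈ (W.erase b).erase e) (hpq : p ≠ q) (hline : rk N (insert y {e, p}) = 2) :
    rk N ((((((gr N).erase b).erase b').erase f).erase e).erase q) = 4 := by
  have hXE : ((((gr N).erase b).erase b').erase f).erase e ⊆ ((gr N).erase b).erase b' :=
    (erase_subset _ _).trans (erase_subset _ _)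
  have hXg : ((((gr N).erase b).erase b').erase f).erase e ⊆ gr N :=
    hXE.trans ((erase_subset _ _).trans (erase_subset _ _))
  have hfE : f ∈ ((gr N).erase b).erase b' := mem_erase.2 ⟨hfb', mem_erase.2 ⟨hfb, hf⟩⟩
  have hy1 : rk N ({y} : Finset α) = 1 := by
    have h1 := rk_insert_le_add_one (N := N) he (X := ({y} : Finset α)) (singleton_subset_iff.2 (hXg hyX))
    have h2 := rk_le_card' (M := N) ({y} : Finset α)
    rw [card_singleton] at h2
    rw [he1 y hyX] at h1
    omega
  have hWd := hW
  simp only [d0DON, mem_filter] at hWd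
  obtain ⟨-, hπX, hπ2, -, -, hπe, hYf, -⟩ := d0_demand_data h hn hf hef heb hfb hfb' (e := e) W hWd.1 hWd.2.1 hWd.2.2
  have hyW := parX_not_mem_of_c1 hn h he hf hef heb heb' hfb hfb' he1 hfc hyX hpar hbb2 hW hc0 hc1 hc2
  have hπeq : (W.erase b).erase e = {p, q} := eq_pair_of_card_two hπ2 hp hq hpq
  have hpX := hπX hp
  have hqX := hπX hq
  have hτ3 := d0_S3 h hn he hf hef heb heb' hfb hfb' _ hπX hπ2 hYf
  have hyτ : y ∈ ((((gr N).erase b).erase b').erase f).erase e \ (W.erase b).erase e := mem_sdiff.2 ⟨hyX, hyW⟩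
  -- `X − q = (X − π) + p`
  have hXq : (((((gr N).erase b).erase b').erase f).erase e).erase q =
      insert p (((((gr N).erase b).erase b').erase f).erase e \ (W.erase b).erase e) := by
    ext a
    rw [mem_erase, mem_insert, mem_sdiff, hπeq, mem_insert, mem_singleton]
    constructor
    · rintro ⟨haq, haX⟩
      by_cases hap : a = p
      · exact Or.inl hap
      · exact Or.inr ⟨haX, by push Not; exact ⟨hap, haq⟩⟩
    · rintro (rfl | ⟨haX, hna⟩)
      · exact ⟨hpq, hpX⟩
      · push Not at hna; exact ⟨hna.2, haX⟩
  by_contra hne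
  -- `p ∈ cl(X − π)`
  have h1 : rk N (insert p (((((gr N).erase b).erase b').erase f).erase e \ (W.erase b).erase e)) = 3 := by
    have h2 := rk_insert_le_add_one (N := N) (hXg hpX)
      (X := ((((gr N).erase b).erase b').erase f).erase e \ (W.erase b).erase e) (sdiff_subset.trans hXg)
    have h3 : rk N (((((gr N).erase b).erase b').erase f).erase e \ (W.erase b).erase e) ≤
        rk N (insert p (((((gr N).erase b).erase b').erase f).erase e \ (W.erase b).erase e)) :=
      rk_mono' (subset_insert _ _)
    rw [hXq] at hne
    omega
  -- `e ∈ cl(X − π)`: either `ρ{p, y} = 2` (then `e ∈ cl{p, y}`) or `y ∥ p` (then the swap is ON and `e ∈ cl(X − π)`)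
  have hecl : rk N (insert e (((((gr N).erase b).erase b').erase f).erase e \ (W.erase b).erase e)) = 3 := by
    by_cases hpy : rk N {p, y} = 2
    · have h4 : rk N (insert e {p, y}) = rk N {p, y} := by
        have h5 : rk N (insert e {p, y}) ≤ rk N (insert y {e, p}) := rk_mono' (by
          intro u hu; simp only [mem_insert, mem_singleton] at hu ⊢; tauto)
        have h6 : rk N {p, y} ≤ rk N (insert e {p, y}) := rk_mono' (subset_insert _ _)
        rw [hline] at h5
        rw [hpy] at h6 ⊢
        omega
      have h5 := rk_insert_eq_of_rk_insert_eq_subset' (N := N) (S := {p, y})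
        (S' := insert p (((((gr N).erase b).erase b').erase f).erase e \ (W.erase b).erase e)) (w := e) (by
          intro u hu; simp only [mem_insert, mem_singleton] at hu
          rcases hu with rfl | rfl
          · exact mem_insert_self _ _
          · exact mem_insert_of_mem hyτ) h4
      rw [h1] at h5
      have h6 : rk N (insert e (((((gr N).erase b).erase b').erase f).erase e \ (W.erase b).erase e)) ≤
          rk N (insert e (insert p (((((gr N).erase b).erase b').erase f).erase e \ (W.erase b).erase e))) :=
        rk_mono' (insert_subset_insert _ (subset_insert _ _))
      have h7 : rk N (((((gr N).erase b).erase b').erase f).erase e \ (W.erase b).erase e) ≤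
          rk N (insert e (((((gr N).erase b).erase b').erase f).erase e \ (W.erase b).erase e)) :=
        rk_mono' (subset_insert _ _)
      rw [h5] at h6
      rw [hτ3] at h7
      omega
    · -- `y ∥ p`: `y ∈ cl(π + f)`, the swap is ON, not bi-independent, `ρ(π + f) = 3` by `c1`
      have hp1 : rk N ({p} : Finset α) = 1 := by
        have h8 := rk_insert_le_add_one (N := N) he (X := {p}) (singleton_subset_iff.2 (hXg hpX))
        have h9 := rk_le_card' (M := N) ({p} : Finset α)
        rw [card_singleton] at h9
        rw [he1 p hpX] at h8
        omega
      have hpy1 : rk N {p, y} = 1 := by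
        have hpy' : p ≠ y := fun h' => hyW (h' ▸ hp)
        have h5 := rk_le_card' (M := N) ({p, y} : Finset α)
        rw [card_pair hpy'] at h5
        have h6 : rk N {p} ≤ rk N {p, y} := rk_mono' (singleton_subset_iff.2 (mem_insert_self _ _))
        rw [hp1] at h6
        omega
      have hyp : rk N (insert y {p}) = rk N {p} := by
        show rk N {y, p} = rk N {p}
        rw [pair_comm' y p, hpy1, hp1]
      have h5 := rk_insert_eq_of_rk_insert_eq_subset' (N := N) (S := {p}) (S' := insert f ((W.erase b).erase e)) (w := y)
        (singleton_subset_iff.2 (mem_insert_of_mem hp)) hyp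
      have hswon := (on_iff_of_parallel h (hXE hyX) hy1 hpar hbb2 (insert_subset hfE (hπX.trans hXE))).2 h5
      unfold d0c1 at hc1
      have h6 := rk_insert_le_add_one (N := N) he (X := insert f ((W.erase b).erase e))
        (insert_subset hf (hπX.trans hXg))
      have h7 := rk_le_card' (M := N) (insert f ((W.erase b).erase e))
      have h8 : (insert f ((W.erase b).erase e)).card ≤ 3 := by
        have := card_insert_le f ((W.erase b).erase e)
        omega
      rw [insert_f_insert_e_comm] at hc1
      have hπf : rk N (insert f ((W.erase b).erase e)) = 3 := by omega
      rw [hπf] at hswon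
      have hτe : rk N (insert e (((((gr N).erase b).erase b').erase f).erase e \ (W.erase b).erase e)) ≠ 4 :=
        fun h' => hc0 ⟨hπf, h', hswon⟩
      have h9 := rk_insert_le_add_one (N := N) he
        (X := ((((gr N).erase b).erase b').erase f).erase e \ (W.erase b).erase e) (sdiff_subset.trans hXg)
      have h10 : rk N (((((gr N).erase b).erase b').erase f).erase e \ (W.erase b).erase e) ≤
          rk N (insert e (((((gr N).erase b).erase b').erase f).erase e \ (W.erase b).erase e)) :=
        rk_mono' (subset_insert _ _)
      omega
  -- `(X + e) − q = (X − π) + p + e` has rank `3`, against `hfc`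
  have h11 := rk_insert_eq_of_rk_insert_eq_subset' (N := N)
    (S := ((((gr N).erase b).erase b').erase f).erase e \ (W.erase b).erase e)
    (S' := insert p (((((gr N).erase b).erase b').erase f).erase e \ (W.erase b).erase e)) (w := e)
    (subset_insert _ _) (by rw [hecl, hτ3])
  have h12 := hfc q hqX
  rw [← insert_e_X_erase_eq he hef heb heb' hqX, hXq, h11, h1] at h12
  omega

/-- **EVERY BAD DEMAND WITH `c1` HAS AN OFF C-ENDPOINT** (regime `b ∥ y`): an endpoint `x` with `ρ{e, f, x} = 3`,
`ρ(X − x) = 4` and `y ∉ cl{e, f, x}`. -/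
theorem parX_off_cpoint_of_c1 (hn : (gr N).card = 9) (h : SeriesPair N b b') {e f : α} (he : e ∈ gr N) (hf : f ∈ gr N)
    (hef : e ≠ f) (heb : e ≠ b) (heb' : e ≠ b') (hfb : f ≠ b) (hfb' : f ≠ b')
    (he1 : ∀ y ∈ ((((gr N).erase b).erase b').erase f).erase e, rk N {e, y} = 2)
    (hf1 : ∀ y ∈ ((((gr N).erase b).erase b').erase f).erase e, rk N {f, y} = 2)
    (hfc : ∀ y ∈ ((((gr N).erase b).erase b').erase f).erase e, rk N (((((gr N).erase b).erase b').erase f).erase y) = 4)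
    (hX : rk N (((((gr N).erase b).erase b').erase f).erase e) = 4)
    {y : α} (hyX : y ∈ ((((gr N).erase b).erase b').erase f).erase e) (hpar : rk N {y, b, b'} = 2)
    (hbb2 : rk N {b, b'} = 2) {W : Finset α} (hW : W ∈ d0DON N b' e f) (hc0 : ¬ d0c0 N b b' e f W)
    (hc1 : d0c1 N b e f W) (hc2 : ¬ d0c2 N b b' e f W) :
    ∃ x ∈ (W.erase b).erase e, rk N {e, f, x} = 3 ∧ rk N ((((((gr N).erase b).erase b').erase f).erase e).erase x) = 4 ∧
      rk N (insert y {e, f, x}) = 4 := by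
  have hXg : ((((gr N).erase b).erase b').erase f).erase e ⊆ gr N :=
    (erase_subset _ _).trans ((erase_subset _ _).trans ((erase_subset _ _).trans (erase_subset _ _)))
  have hWd := hW
  simp only [d0DON, mem_filter] at hWd
  obtain ⟨-, hπX, hπ2, -, -, hπe, hYf, -⟩ := d0_demand_data h hn hf hef heb hfb hfb' (e := e) W hWd.1 hWd.2.1 hWd.2.2
  obtain ⟨p, q, hpq, hπeq⟩ := card_eq_two.1 hπ2
  have hp : p ∈ (W.erase b).erase e := by rw [hπeq]; exact mem_insert_self _ _
  have hq : q ∈ (W.erase b).erase e := by rw [hπeq]; exact mem_insert_of_mem (mem_singleton_self _)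
  have hpX := hπX hp
  have hqX := hπX hq
  have hpL := parX_off_line_of_c1 hn h he hf hef heb hfb hfb' hf1 hW hc1 hp
  have hqL := parX_off_line_of_c1 hn h he hf hef heb hfb hfb' hf1 hW hc1 hq
  have hbnd : ∀ x ∈ (W.erase b).erase e, rk N {e, f, x} = 3 →
      3 ≤ rk N (insert y {e, f, x}) ∧ rk N (insert y {e, f, x}) ≤ 4 := by
    intro x hx hx3
    have h1 : rk N {e, f, x} ≤ rk N (insert y {e, f, x}) := rk_mono' (subset_insert _ _)
    have h2 := rk_insert_le_add_one (N := N) (hXg hyX) (X := {e, f, x})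
      (insert_subset he (insert_subset hf (singleton_subset_iff.2 (hXg (hπX hx)))))
    rw [hx3] at h1 h2
    exact ⟨h1, h2⟩
  have hτ3 := d0_S3 h hn he hf hef heb heb' hfb hfb' _ hπX hπ2 hYf
  by_cases hpON : rk N (insert y {e, f, p}) = 4
  · by_cases hqON : rk N (insert y {e, f, q}) = 4
    · -- both endpoints OFF-type: one of them has `ρ(X − x) = 4`
      by_cases hp4 : rk N ((((((gr N).erase b).erase b').erase f).erase e).erase p) = 4
      · exact ⟨p, hp, hpL, hp4, hpON⟩
      by_cases hq4 : rk N ((((((gr N).erase b).erase b').erase f).erase e).erase q) = 4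
      · exact ⟨q, hq, hqL, hq4, hqON⟩
      exfalso
      -- `p, q ∈ cl(X − π)`, so `ρX ≤ 3`
      have hXp : (((((gr N).erase b).erase b').erase f).erase e).erase p =
          insert q (((((gr N).erase b).erase b').erase f).erase e \ (W.erase b).erase e) := by
        ext a
        rw [mem_erase, mem_insert, mem_sdiff, hπeq, mem_insert, mem_singleton]
        constructor
        · rintro ⟨hap, haX⟩
          by_cases haq : a = q
          · exact Or.inl haq
          · exact Or.inr ⟨haX, by push Not; exact ⟨hap, haq⟩⟩
        · rintro (rfl | ⟨haX, hna⟩)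
          · exact ⟨hpq.symm, hqX⟩
          · push Not at hna; exact ⟨hna.1, haX⟩
      have hXq : (((((gr N).erase b).erase b').erase f).erase e).erase q =
          insert p (((((gr N).erase b).erase b').erase f).erase e \ (W.erase b).erase e) := by
        ext a
        rw [mem_erase, mem_insert, mem_sdiff, hπeq, mem_insert, mem_singleton]
        constructor
        · rintro ⟨haq, haX⟩
          by_cases hap : a = p
          · exact Or.inl hap
          · exact Or.inr ⟨haX, by push Not; exact ⟨hap, haq⟩⟩
        · rintro (rfl | ⟨haX, hna⟩)
          · exact ⟨hpq, hpX⟩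
          · push Not at hna; exact ⟨hna.2, haX⟩
      rw [hXp] at hp4
      rw [hXq] at hq4
      have hτg : ((((gr N).erase b).erase b').erase f).erase e \ (W.erase b).erase e ⊆ gr N := sdiff_subset.trans hXg
      have h1 : rk N (insert q (((((gr N).erase b).erase b').erase f).erase e \ (W.erase b).erase e)) =
          rk N (((((gr N).erase b).erase b').erase f).erase e \ (W.erase b).erase e) := by
        have h2 := rk_insert_le_add_one (N := N) (hXg hqX)
          (X := ((((gr N).erase b).erase b').erase f).erase e \ (W.erase b).erase e) hτg
        have h3 : rk N (((((gr N).erase b).erase b').erase f).erase e \ (W.erase b).erase e) ≤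
            rk N (insert q (((((gr N).erase b).erase b').erase f).erase e \ (W.erase b).erase e)) :=
          rk_mono' (subset_insert _ _)
        omega
      have h4 : rk N (insert p (((((gr N).erase b).erase b').erase f).erase e \ (W.erase b).erase e)) =
          rk N (((((gr N).erase b).erase b').erase f).erase e \ (W.erase b).erase e) := by
        have h2 := rk_insert_le_add_one (N := N) (hXg hpX)
          (X := ((((gr N).erase b).erase b').erase f).erase e \ (W.erase b).erase e) hτg
        have h3 : rk N (((((gr N).erase b).erase b').erase f).erase e \ (W.erase b).erase e) ≤
            rk N (insert p (((((gr N).erase b).erase b').erase f).erase e \ (W.erase b).erase e)) :=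
          rk_mono' (subset_insert _ _)
        omega
      have h5 := rk_insert_eq_of_rk_insert_eq_subset' (N := N)
        (S := ((((gr N).erase b).erase b').erase f).erase e \ (W.erase b).erase e)
        (S' := insert q (((((gr N).erase b).erase b').erase f).erase e \ (W.erase b).erase e)) (w := p)
        (subset_insert _ _) h4
      rw [h1, hτ3] at h5
      have h6 : rk N (((((gr N).erase b).erase b').erase f).erase e) ≤
          rk N (insert p (insert q (((((gr N).erase b).erase b').erase f).erase e \ (W.erase b).erase e))) := by
        apply rk_mono'
        intro a ha
        by_cases hap : a = p
        · rw [hap]; exact mem_insert_self _ _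
        by_cases haq : a = q
        · rw [haq]; exact mem_insert_of_mem (mem_insert_self _ _)
        refine mem_insert_of_mem (mem_insert_of_mem (mem_sdiff.2 ⟨ha, ?_⟩))
        rw [hπeq, mem_insert, mem_singleton]; push Not; exact ⟨hap, haq⟩
      rw [h5, hX] at h6
      omega
    · -- `q` is ON-type: `y ∈ cl{e, q}`, so `ρ(X − p) = 4`, and `p` is OFF-type
      have hq3 : rk N (insert y {e, f, q}) = 3 := by
        have := hbnd q hq hqL; omega
      have hline := parX_line_of_plane hn h he hf hef heb heb' hfb hfb' he1 hf1 hyX hpar hbb2 hW hc1 hq hq3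
      have hp4 := parX_rk_erase_eq_four_of_line hn h he hf hef heb heb' hfb hfb' he1 hfc hyX hpar hbb2 hW hc0 hc1 hc2
        hq hp hpq.symm hline
      exact ⟨p, hp, hpL, hp4, hpON⟩
  · -- `p` is ON-type: `y ∈ cl{e, p}`; then `q` is OFF-type and `ρ(X − q) = 4`
    have hp3 : rk N (insert y {e, f, p}) = 3 := by
      have := hbnd p hp hpL; omega
    have hlinep := parX_line_of_plane hn h he hf hef heb heb' hfb hfb' he1 hf1 hyX hpar hbb2 hW hc1 hp hp3
    have hqON : rk N (insert y {e, f, q}) = 4 := by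
      by_contra hne
      have hq3 : rk N (insert y {e, f, q}) = 3 := by
        have := hbnd q hq hqL; omega
      have hlineq := parX_line_of_plane hn h he hf hef heb heb' hfb hfb' he1 hf1 hyX hpar hbb2 hW hc1 hq hq3
      -- the two lines through `e, y` coincide: `ρ{e, p, q} ≤ 2`
      have h1 := rk_union_add_rk_le_of_subset_inter' (N := N) (S := insert y {e, p}) (T := insert y {e, q})
        (I := {e, y}) (by
          intro u hu; simp only [mem_insert, mem_singleton] at hu
          rcases hu with rfl | rfl
          · exact mem_inter.2 ⟨mem_insert_of_mem (mem_insert_self _ _), mem_insert_of_mem (mem_insert_self _ _)⟩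
          · exact mem_inter.2 ⟨mem_insert_self _ _, mem_insert_self _ _⟩)
      rw [hlinep, hlineq, he1 y hyX] at h1
      have h2 : rk N (insert e ((W.erase b).erase e)) ≤ rk N (insert y {e, p} ∪ insert y {e, q}) := by
        apply rk_mono'
        intro u hu
        rw [mem_insert, hπeq, mem_insert, mem_singleton] at hu
        rcases hu with rfl | rfl | rfl
        · exact mem_union_left _ (mem_insert_of_mem (mem_insert_self _ _))
        · exact mem_union_left _ (mem_insert_of_mem (mem_insert_of_mem (mem_singleton_self _)))
        · exact mem_union_right _ (mem_insert_of_mem (mem_insert_of_mem (mem_singleton_self _)))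
      rw [hπe] at h2
      omega
    have hq4 := parX_rk_erase_eq_four_of_line hn h he hf hef heb heb' hfb hfb' he1 hfc hyX hpar hbb2 hW hc0 hc1 hc2
      hp hq hpq hlinep
    exact ⟨q, hq, hqL, hq4, hqON⟩

end StarSharpParXB

end PercRepro.Cogirth
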